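import Summits.FinalStateConjecture.FinalStateConjecture.Theorems.PhotonSphereChannelsKerrDevDefs
import HarnessLib

/-!
# Route PhotonSphereChannels · crux `ChannelsResolveTameDevelopmentsR` (K2R, stmt-FinalStateConjecture-14075), line
# `kerr-isolation-dichotomy` — the hypothesis of S6 is the strongest statement of the chain S4 → S5 → S6

The three path-quantified stubs of the line speak about the anchored Kerr window deviation
`s ↦ kerrDev 𝒟 (γ s) R` along one continuous future-escaping outer path `γ` at one scale `R`:
* S4 `stub_noEternallyStrangeEnd` concludes: FREQUENTLY `≤ δ`, for every `δ > 0`;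
* S5 `stub_hullConnectedness` concludes: frequently `≤ a` and frequently `≥ b` (`a < b`) ⇒ frequently in the band
  `[a, b]`;
* S6 `stub_exhaustionFromKerrAsymptotics` ASSUMES: `kerrDev 𝒟 (γ s) R → 0` as `s → ∞`.
This file records the elementary order-theoretic fact that S6's per-path hypothesis implies S4's and S5's per-path
conclusions outright (registered sub-goal `stub_pathTendsto_consequences` of `stub_exhaustionFromKerrAsymptotics`):
convergence to `0` gives EVENTUALLY `≤ δ` (hence frequently), and makes "frequently `≥ b`" impossible for `b > 0`,
so the band implication holds vacuously. Together with `stub_exists_futureEscapingPath`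
(`…RFutureEscapingPaths.lean`: such paths exist through every outer point) this documents that the composition
`pathTendsto` of the skeleton (S1–S5 ⇒ S6's hypothesis) is the only direction with content. Pure filter/order theory
on `ℝ≥0∞` (`ge_mem_nhds`, `gt_mem_nhds`); stated over an arbitrary spacetime `𝓢` and path `γ` (for the line,
`𝓢 = 𝒟.toSpacetime`). No definitions, no named facts.
-/

noncomputable section

-- the operator-norm instance on `E4 →L[ℝ] E4 →L[ℝ] ℝ` needs one more level of pending
-- instance problems than the default (as in `PhotonSphereChannelsKerrDevDefs.lean`)
set_option maxSynthPendingDepth 3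
-- every `Summit.FinalStateConjecture.FinalStateConjecture.…` name repeats the summit = sub-problem segment (D-0017 layout)
set_option linter.dupNamespace false

open Set Filter Function TopologicalSpace
open scoped Topology ENNReal NNReal


namespace Summit.FinalStateConjecture.FinalStateConjecture.Theorems

open Literature.Geometry.Lorentzian
open Summit.FinalStateConjecture.FinalStateConjecture.Theorems.TameHull

/-- A function `ℝ → ℝ≥0∞` tending to `0` at `+∞` is eventually (in particular frequently) below every positive
level. [folklore] -/
theorem eventually_le_of_tendsto_zero {u : ℝ → ℝ≥0∞} (h : Tendsto u atTop (𝓝 0)) {δ : ℝ≥0∞} (hδ : 0 < δ) :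
    ∀ᶠ s in atTop, u s ≤ δ :=
  h.eventually (ge_mem_nhds hδ)

/-- A function `ℝ → ℝ≥0∞` tending to `0` at `+∞` is NOT frequently above a positive level. [folklore] -/
theorem not_frequently_le_of_tendsto_zero {u : ℝ → ℝ≥0∞} (h : Tendsto u atTop (𝓝 0)) {b : ℝ≥0∞}
    (hb : 0 < b) : ¬ ∃ᶠ s in atTop, b ≤ u s :=
  Filter.not_frequently.2 ((h.eventually (gt_mem_nhds hb)).mono fun _ hs ↦ not_le.2 hs)

/-- **S6's per-path hypothesis implies S4's and S5's per-path conclusions.** If `kerrDev 𝓢 (γ s) R → 0` as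
`s → ∞` (the hypothesis of `stub_exhaustionFromKerrAsymptotics` for the path `γ` at scale `R`), then (S4's
conclusion) `kerrDev 𝓢 (γ s) R ≤ δ` frequently — indeed eventually — for every `δ > 0`, and (S5's conclusion) the
band statement holds for all levels `a < b`, vacuously: `b > 0`, so `kerrDev 𝓢 (γ s) R ≥ b` is not frequent.
[folklore] -/
theorem pathTendsto_consequences {𝓢 : Spacetime.{0} 4} (γ : ℝ → 𝓢.carrier) (R : ℝ)
    (h : Tendsto (fun s ↦ kerrDev 𝓢 (γ s) R) atTop (𝓝 0)) :
    (∀ δ : ℝ≥0∞, 0 < δ → ∃ᶠ s in atTop, kerrDev 𝓢 (γ s) R ≤ δ) ∧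
      ∀ a b : ℝ≥0∞, a < b → (∃ᶠ s in atTop, kerrDev 𝓢 (γ s) R ≤ a) →
        (∃ᶠ s in atTop, b ≤ kerrDev 𝓢 (γ s) R) →
          ∃ᶠ s in atTop, a ≤ kerrDev 𝓢 (γ s) R ∧ kerrDev 𝓢 (γ s) R ≤ b :=
  ⟨fun _ hδ ↦ (eventually_le_of_tendsto_zero h hδ).frequently,
    fun _ _ hab _ hb ↦ absurd hb (not_frequently_le_of_tendsto_zero h (lt_of_le_of_lt bot_le hab))⟩

/-- **Registered sub-goal `stub_pathTendsto_consequences` of `stub_exhaustionFromKerrAsymptotics` (S6), line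
`kerr-isolation-dichotomy`: the hypothesis of S6 is the strongest per-path statement of the chain.** For every
spacetime `𝓢`, path `γ : ℝ → 𝓢` and scale `R`: `kerrDev 𝓢 (γ s) R → 0` (S6's hypothesis) implies the conclusion of
S4 `stub_noEternallyStrangeEnd` (frequently `≤ δ` for every `δ > 0`) and the conclusion of S5 `stub_hullConnectedness`
(the band statement for all `a < b`) for the same path and scale — with `𝓢 = 𝒟.toSpacetime` these are the stubs'
conclusions verbatim (`pathTendsto_consequences`). [folklore] -/
theorem stub_pathTendsto_consequences : ∀ {𝓢 : Spacetime.{0} 4} (γ : ℝ → 𝓢.carrier) (R : ℝ), Tendsto (fun s ↦ kerrDev 𝓢 (γ s) R) atTop (𝓝 0) → (∀ δ : ℝ≥0∞, 0 < δ → ∃ᶠ s in atTop, kerrDev 𝓢 (γ s) R ≤ δ) ∧ ∀ a b : ℝ≥0∞, a < b → (∃ᶠ s in atTop, kerrDev 𝓢 (γ s) R ≤ a) → (∃ᶠ s in atTop, b ≤ kerrDev 𝓢 (γ s) R) → ∃ᶠ s in atTop, a ≤ kerrDev 𝓢 (γ s) R ∧ kerrDev 𝓢 (γ s) R ≤ b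 :=
  fun γ R h ↦ pathTendsto_consequences γ R h

end Summit.FinalStateConjecture.FinalStateConjecture.Theorems

end
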